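import Mathlib
import Literature.Analysis.SpecialFunctions.PolygammaSeries
import Literature.NumberTheory.LFunctions.EulerMaclaurinZetaHigher
import Literature.Barriers.RiemannHypothesis.MollifierLimitationsLemma2Proofs
import HarnessLib

/-!
# Stirling's series for the Hurwitz-type sums `Σ_j (w+j)^{-s}` and the polygamma functions, with explicit remainder

Topic `Literature/Analysis/SpecialFunctions`, namespace `Literature.Analysis.SpecialFunctions.Complex`
(sibling of `DigammaStirlingSeries.lean`, which does `ψ` and `ψ′`).  Everything is proved.

**Theorem** (`norm_tsum_inv_pow_sub_stirling_le`).  For `Re w > 0`, integers `p ≥ 1`, `ν ≥ 1`,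

  `‖Σ_{j≥0} (w+j)^{−(p+1)} − ( 1/(p w^p) + 1/(2 w^{p+1})`
  `      + Σ_{k=1}^{ν} (B_{2k}/(2k)!) · (p+1)(p+2)⋯(p+2k−1) / w^{p+2k} )‖`
  `   ≤ ((p+1)(p+2)⋯(p+2ν+1)/(2ν+1)!) · (π²/3)(2ν+1)!/(2π)^{2ν+1} · 1/(‖w‖^{p+2ν} · Re w)`

(Euler–Maclaurin of order `ν`, the tree's `Literature.Barriers.RiemannHypothesis.Lemma2.eulerMaclaurin_family`,
applied to the derivative family `x ↦ (−1)^j (p+1)^{(j)} (w+x)^{−(p+1+j)}` on `[0, n]`, `n → ∞`; the periodic Bernoulli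
function is bounded by `abs_bernoulliPer_odd_le`), i.e. DLMF 25.11.5 / 5.15.8 at integer argument with an explicit
(not sharp) remainder valid in the whole right half-plane; the case `p = 1` is the trigamma series of
`DigammaStirlingSeries.lean`.  Corollaries:

* `norm_iteratedDeriv_digamma_sub_stirling_le` — the same for `ψ^{(p)}(w) = (−1)^{p+1} p! Σ_j (w+j)^{−(p+1)}`
  (`PolygammaSeries.hasSum_iteratedDeriv_digamma`);
* `tsum_inv_pow_eq_sum_add_tsum_shift` — `Σ_j (w+j)^{−s} = Σ_{j<J} (w+j)^{−s} + Σ_j (w+J+j)^{−s}`, the shift that makes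
  the remainder as small as desired;
* the RATIONAL form consumed by kernel certificates (`decide`) is in the sequel `HurwitzZetaRationalEnclosure.lean`
  (`hurwitzNatMain`, `hurwitzNatTail`, `abs_tsum_inv_pow_sub_hurwitzNatMain_le`).

Use: certified values of `ζ(s, c)` at integers — `ζ(3)`, `ζ(5)`, …, `β(2k)` through `c = ¼, ¾`, `ψ^{(p)}(¼)` — and, first
consumer, the main parts `Σ_k p!/l_k^{p+1}` (`l_k = 2k + ½`) of the window constants `W_p(a)` of the C∞ design of the
Weil-positivity kernel certificates (`Summits/…/WeilFormatCPolyWindowConstants.lean`, seat rh-explicit-weil-10/weil-2).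

## References
* NIST DLMF §25.11(iii) (25.11.5: Euler–Maclaurin for `ζ(s,a)`), §5.15 (polygamma asymptotics). [cite: DLMF, 25.11.5]
* G. E. Andrews, R. Askey, R. Roy, *Special Functions* (1999), (1.2.14) and Cor. 1.4.5. [cite: AndrewsAskeyRoy1999, (1.2.14)]
* H. M. Edwards, *Riemann's Zeta Function* (1974), §6.4. [cite: Edwards1974, §6.4]
-/

noncomputable section

open Complex Real Set Filter Topology MeasureTheory intervalIntegral

namespace Literature.Analysis.SpecialFunctions.Complex

open Literature.NumberTheory.LFunctions (bernoulliPer abs_bernoulliPer_odd_le measurable_bernoulliPer)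
open Literature.Barriers.RiemannHypothesis.Lemma2 (eulerMaclaurin_family)

/-! ### The derivative family `x ↦ (−1)^j (p+1)^{(j)} (w+x)^{−(p+1+j)}` -/

/-- `w + x ≠ 0` for `Re w > 0`, `x ≥ 0`. [folklore] -/
private lemma add_ofReal_ne_zero' {w : ℂ} (hw : 0 < w.re) {x : ℝ} (hx : 0 ≤ x) : w + (x : ℂ) ≠ 0 := by
  intro h
  have := congrArg Complex.re h
  simp at this
  linarith

/-- The family `x ↦ (−1)^j (p+1)^{(j)} (w+x)^{-(p+1+j)}` ((p+1)^{(j)} the rising factorial) is a derivative family on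
`[0, ∞)`. [folklore] -/
private lemma hasDerivAt_powFam {w : ℂ} (hw : 0 < w.re) (p j : ℕ) {x : ℝ} (hx : 0 ≤ x) :
    HasDerivAt (fun y : ℝ ↦ (-1 : ℂ) ^ j * ((p + 1).ascFactorial j : ℂ) * (w + y) ^ (-(p + 1 + j : ℤ)))
      ((-1 : ℂ) ^ (j + 1) * ((p + 1).ascFactorial (j + 1) : ℂ) * (w + x) ^ (-(p + 1 + (j + 1) : ℤ))) x := by
  have hne : w + (x : ℂ) ≠ 0 := add_ofReal_ne_zero' hw hx
  have h1 := hasDerivAt_zpow (-(p + 1 + j : ℤ)) (w + (x : ℂ)) (Or.inl hne)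
  have h2 : HasDerivAt (fun z : ℂ ↦ w + z) 1 (x : ℂ) := (hasDerivAt_id _).const_add w
  have h3 := (h1.comp (x : ℂ) h2).comp_ofReal
  have h4 := h3.const_mul ((-1 : ℂ) ^ j * ((p + 1).ascFactorial j : ℂ))
  simp only [Function.comp_def, mul_one] at h4
  refine h4.congr_deriv ?_
  have e : (-(p + 1 + j : ℤ) - 1 : ℤ) = -(p + 1 + (j + 1) : ℤ) := by ring
  rw [e, Nat.ascFactorial_succ]
  push_cast
  ring

/-- `‖(w+x)^{-(m+2)}‖ ≤ ‖w‖^{-m}·(Re w + x)^{-2}` for `x ≥ 0`. [folklore] -/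
private lemma norm_zpow_neg_le' {w : ℂ} (hw : 0 < w.re) (m : ℕ) {x : ℝ} (hx : 0 ≤ x) :
    ‖(w + x) ^ (-(m + 2 : ℤ))‖ ≤ (‖w‖ ^ m)⁻¹ * ((w.re + x) ^ 2)⁻¹ := by
  have hwpos : 0 < ‖w‖ := norm_pos_iff.mpr (fun h ↦ by rw [h] at hw; simp at hw)
  have hre : 0 < w.re + x := by linarith
  have hn1 : ‖w‖ ≤ ‖w + x‖ := by
    have h1 : ‖w‖ ^ 2 ≤ ‖w + x‖ ^ 2 := by
      rw [Complex.sq_norm, Complex.sq_norm, Complex.normSq_apply, Complex.normSq_apply]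
      simp only [add_re, ofReal_re, add_im, ofReal_im, add_zero]
      nlinarith
    exact (pow_le_pow_iff_left₀ (norm_nonneg w) (norm_nonneg _) two_ne_zero).mp h1
  have hn2 : w.re + x ≤ ‖w + x‖ := by
    have := Complex.re_le_norm (w + x)
    simpa using this
  rw [show (-(m + 2 : ℤ)) = -((m + 2 : ℕ) : ℤ) by push_cast; ring, zpow_neg, norm_inv, zpow_natCast,
    norm_pow, ← mul_inv]
  refine inv_anti₀ (by positivity) ?_
  calc ‖w‖ ^ m * (w.re + x) ^ 2 ≤ ‖w + x‖ ^ m * ‖w + x‖ ^ 2 :=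
        mul_le_mul (pow_le_pow_left₀ hwpos.le hn1 m) (pow_le_pow_left₀ hre.le hn2 2)
          (by positivity) (by positivity)
    _ = ‖w + (x : ℂ)‖ ^ (m + 2) := by rw [pow_add]

/-- Remainder bound: `‖∫_0^n B̄_{2ν+1}(x) (w+x)^{-(m+2)} dx‖ ≤ (π²/3)(2ν+1)!/(2π)^{2ν+1} / (‖w‖^{m} Re w)`,
uniformly in `n`. [folklore] -/
private lemma norm_integral_bernoulliPer_mul_zpow_le' {w : ℂ} (hw : 0 < w.re) {ν : ℕ} (hν : ν ≠ 0) (m n : ℕ) :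
    ‖∫ x in (0 : ℝ)..n, (bernoulliPer (2 * ν + 1) x : ℂ) * (w + x) ^ (-(m + 2 : ℤ))‖ ≤
      Real.pi ^ 2 / 3 * ((2 * ν + 1).factorial : ℝ) / (2 * Real.pi) ^ (2 * ν + 1) /
        (‖w‖ ^ m * w.re) := by
  set C : ℝ := Real.pi ^ 2 / 3 * ((2 * ν + 1).factorial : ℝ) / (2 * Real.pi) ^ (2 * ν + 1) with hC
  have hC0 : 0 ≤ C := by rw [hC]; positivity
  have hwpos : 0 < ‖w‖ := norm_pos_iff.mpr (fun h ↦ by rw [h] at hw; simp at hw)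
  set K : ℝ := C * (‖w‖ ^ m)⁻¹ with hK
  have hK0 : 0 ≤ K := by rw [hK]; positivity
  have hn0 : (0 : ℝ) ≤ n := Nat.cast_nonneg n
  have hpt : ∀ᵐ x : ℝ, x ∈ Ioc (0 : ℝ) n →
      ‖(bernoulliPer (2 * ν + 1) x : ℂ) * (w + x) ^ (-(m + 2 : ℤ))‖ ≤ K * ((w.re + x) ^ 2)⁻¹ := by
    refine ae_of_all _ fun x hx ↦ ?_
    rw [norm_mul, Complex.norm_real, Real.norm_eq_abs, hK, mul_assoc]
    exact mul_le_mul (abs_bernoulliPer_odd_le hν x) (norm_zpow_neg_le' hw m hx.1.le) (norm_nonneg _) hC0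
  have hderiv : ∀ x ∈ uIcc (0 : ℝ) n, HasDerivAt (fun y : ℝ ↦ -K * (w.re + y)⁻¹) (K * ((w.re + x) ^ 2)⁻¹) x := by
    intro x hx
    rw [uIcc_of_le hn0] at hx
    have hne : w.re + x ≠ 0 := by linarith [hx.1]
    have h1 : HasDerivAt (fun y : ℝ ↦ w.re + y) 1 x := (hasDerivAt_id x).const_add _
    have h2 := (h1.inv hne).const_mul (-K)
    refine h2.congr_deriv ?_
    field_simp
  have hcont : ContinuousOn (fun x : ℝ ↦ K * ((w.re + x) ^ 2)⁻¹) (uIcc (0 : ℝ) n) := by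
    rw [uIcc_of_le hn0]
    refine ContinuousOn.mul continuousOn_const (ContinuousOn.inv₀ (by fun_prop) fun x hx ↦ ?_)
    have : 0 < w.re + x := by linarith [hx.1]
    positivity
  have hint : IntervalIntegrable (fun x : ℝ ↦ K * ((w.re + x) ^ 2)⁻¹) volume 0 n := hcont.intervalIntegrable
  have hval : ∫ x in (0 : ℝ)..n, K * ((w.re + x) ^ 2)⁻¹ = -K * (w.re + n)⁻¹ - -K * (w.re + 0)⁻¹ :=
    integral_eq_sub_of_hasDerivAt hderiv hint
  calc ‖∫ x in (0 : ℝ)..n, (bernoulliPer (2 * ν + 1) x : ℂ) * (w + x) ^ (-(m + 2 : ℤ))‖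
      ≤ ∫ x in (0 : ℝ)..n, K * ((w.re + x) ^ 2)⁻¹ := intervalIntegral.norm_integral_le_of_norm_le hn0 hpt hint
    _ = K * ((w.re)⁻¹ - (w.re + n)⁻¹) := by rw [hval]; ring
    _ ≤ K * (w.re)⁻¹ := by
        refine mul_le_mul_of_nonneg_left ?_ hK0
        have : 0 ≤ (w.re + n)⁻¹ := by positivity
        linarith
    _ = C / (‖w‖ ^ m * w.re) := by rw [hK]; field_simp

/-- `Σ_{j ≤ n} f j = f 0 + Σ_{0 < m ≤ n} f m`. [folklore] -/
private lemma sum_range_succ_eq_add_sum_Ioc' {M : Type*} [AddCommMonoid M] (f : ℕ → M) (n : ℕ) :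
    ∑ j ∈ Finset.range (n + 1), f j = f 0 + ∑ m ∈ Finset.Ioc 0 n, f m := by
  induction n with
  | zero => simp
  | succ n ih => rw [Finset.sum_range_succ, ih, Finset.sum_Ioc_succ_top (Nat.zero_le _), add_assoc]

/-- `‖(w + n)^{-q}‖ → 0` for `q ≥ 1` (`Re w > 0`). [folklore] -/
private lemma tendsto_inv_pow_add_nat' {w : ℂ} (hw : 0 < w.re) {q : ℕ} (hq : 1 ≤ q) :
    Tendsto (fun n : ℕ ↦ ((w + n) ^ q)⁻¹) atTop (𝓝 0) := by
  refine squeeze_zero_norm' ?_ tendsto_one_div_atTop_nhds_zero_nat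
  filter_upwards [eventually_ge_atTop 1] with n hn
  have hn1 : (1 : ℝ) ≤ n := by exact_mod_cast hn
  have hre : (n : ℝ) ≤ ‖w + n‖ := by
    have := Complex.re_le_norm (w + n)
    simp at this
    linarith
  rw [norm_inv, norm_pow, one_div]
  refine inv_anti₀ (by positivity) ?_
  calc (n : ℝ) ≤ (n : ℝ) ^ q := le_self_pow₀ hn1 (by omega)
    _ ≤ ‖w + n‖ ^ q := pow_le_pow_left₀ (by positivity) hre q

/-! ### Summability and the shift -/

/-- `Σ_j (w+j)^{-(p+1)}` converges for `Re w > 0`, `p ≥ 1` (from the polygamma series).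
[cite: AndrewsAskeyRoy1999, (1.2.14)] -/
theorem summable_inv_pow_add_nat {w : ℂ} (hw : 0 < w.re) {p : ℕ} (hp : 1 ≤ p) :
    Summable (fun j : ℕ ↦ ((w + j) ^ (p + 1))⁻¹) := by
  have h := (hasSum_iteratedDeriv_digamma hw hp).summable.mul_left
    (((-1 : ℂ) ^ (p + 1) * (p.factorial : ℂ))⁻¹)
  refine h.congr fun j ↦ ?_
  have hc : ((-1 : ℂ) ^ (p + 1) * (p.factorial : ℂ)) ≠ 0 :=
    mul_ne_zero (pow_ne_zero _ (by norm_num)) (by exact_mod_cast Nat.factorial_ne_zero p)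
  rw [← mul_assoc, inv_mul_cancel₀ hc, one_mul]

/-- **The shift**: `Σ_j (w+j)^{-(p+1)} = Σ_{j<J} (w+j)^{-(p+1)} + Σ_j (w+J+j)^{-(p+1)}` (`Re w > 0`, `p ≥ 1`).
[cite: AndrewsAskeyRoy1999, (1.2.14)] -/
theorem tsum_inv_pow_eq_sum_add_tsum_shift {w : ℂ} (hw : 0 < w.re) {p : ℕ} (hp : 1 ≤ p) (J : ℕ) :
    ∑' j : ℕ, ((w + j) ^ (p + 1))⁻¹ =
      ∑ j ∈ Finset.range J, ((w + j) ^ (p + 1))⁻¹ + ∑' j : ℕ, ((w + J + j) ^ (p + 1))⁻¹ := by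
  have h := (summable_inv_pow_add_nat hw hp).sum_add_tsum_nat_add J
  rw [← h]
  congr 1
  refine tsum_congr fun j ↦ ?_
  push_cast
  ring_nf

/-! ### The main theorem -/

/-- **Stirling's series for `Σ_j (w+j)^{-(p+1)}` with an explicit remainder of every order** (`Re w > 0`, `p ≥ 1`,
`ν ≥ 1`):
`‖Σ_j (w+j)^{−(p+1)} − (1/(p w^p) + 1/(2w^{p+1}) + Σ_{k=1}^{ν} (B_{2k}/(2k)!) (p+1)^{(2k−1)} / w^{p+2k})‖`
`≤ ((p+1)^{(2ν+1)}/(2ν+1)!) (π²/3)(2ν+1)!/(2π)^{2ν+1} / (‖w‖^{p+2ν} Re w)` (`(p+1)^{(m)} = (p+1)(p+2)⋯(p+m)`).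
[cite: DLMF, 25.11.5] -/
theorem norm_tsum_inv_pow_sub_stirling_le {w : ℂ} (hw : 0 < w.re) {p : ℕ} (hp : 1 ≤ p) {ν : ℕ} (hν : ν ≠ 0) :
    ‖(∑' j : ℕ, ((w + j) ^ (p + 1))⁻¹) - (1 / (p * w ^ p) + 1 / (2 * w ^ (p + 1)) +
        ∑ k ∈ Finset.Icc 1 ν, (bernoulli (2 * k) : ℂ) / (2 * k).factorial *
          ((p + 1).ascFactorial (2 * k - 1) : ℂ) / w ^ (p + 2 * k))‖ ≤
      (((p + 1).ascFactorial (2 * ν + 1) : ℝ) / (2 * ν + 1).factorial) *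
        (Real.pi ^ 2 / 3 * ((2 * ν + 1).factorial : ℝ) / (2 * Real.pi) ^ (2 * ν + 1)) /
        (‖w‖ ^ (p + 2 * ν) * w.re) := by
  -- the derivative family
  set F : ℕ → ℝ → ℂ := fun j y ↦ (-1 : ℂ) ^ j * ((p + 1).ascFactorial j : ℂ) * (w + y) ^ (-(p + 1 + j : ℤ))
    with hF
  set Main : ℂ := 1 / (p * w ^ p) + 1 / (2 * w ^ (p + 1)) +
        ∑ k ∈ Finset.Icc 1 ν, (bernoulli (2 * k) : ℂ) / (2 * k).factorial *
          ((p + 1).ascFactorial (2 * k - 1) : ℂ) / w ^ (p + 2 * k) with hMain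
  set C : ℝ := Real.pi ^ 2 / 3 * ((2 * ν + 1).factorial : ℝ) / (2 * Real.pi) ^ (2 * ν + 1) with hC
  set A : ℝ := ((p + 1).ascFactorial (2 * ν + 1) : ℝ) / (2 * ν + 1).factorial with hA
  set Bnd : ℝ := A * C / (‖w‖ ^ (p + 2 * ν) * w.re) with hBnd
  have hw0 : w ≠ 0 := fun h ↦ by rw [h] at hw; simp at hw
  have hwpos : 0 < ‖w‖ := norm_pos_iff.mpr hw0
  have hC0 : 0 ≤ C := by rw [hC]; positivity
  have hA0 : 0 ≤ A := by rw [hA]; positivity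
  have hp0 : (p : ℂ) ≠ 0 := by exact_mod_cast (show p ≠ 0 by omega)
  -- `F` is a derivative family on `[0, n]`
  have hFderiv : ∀ n : ℕ, ∀ j, ∀ x ∈ Icc ((0 : ℕ) : ℝ) n, HasDerivAt (F j) (F (j + 1) x) x := by
    intro n j x hx
    have hx0 : 0 ≤ x := by simpa using hx.1
    exact hasDerivAt_powFam hw p j hx0
  -- values
  have hF0 : ∀ y : ℝ, 0 ≤ y → F 0 y = ((w + y) ^ (p + 1))⁻¹ := by
    intro y hy
    simp only [hF, pow_zero, Nat.ascFactorial_zero, Nat.cast_one, one_mul, Nat.cast_zero, add_zero]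
    rw [show (-(p + 1 : ℤ)) = -((p + 1 : ℕ) : ℤ) by push_cast; ring, zpow_neg, zpow_natCast]
  have hF1 : ∀ k, 1 ≤ k → ∀ y : ℝ, 0 ≤ y →
      (bernoulli (2 * k) : ℂ) / ((2 * k).factorial : ℂ) * F (2 * k - 1) y =
        -((bernoulli (2 * k) : ℂ) / ((2 * k).factorial : ℂ) * ((p + 1).ascFactorial (2 * k - 1) : ℂ) *
          ((w + y) ^ (p + 2 * k))⁻¹) := by
    intro k hk y hy
    obtain ⟨k', rfl⟩ : ∃ k', k = k' + 1 := ⟨k - 1, by omega⟩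
    have e1 : 2 * (k' + 1) - 1 = 2 * k' + 1 := by omega
    rw [e1]
    have hFval : F (2 * k' + 1) y = -(((p + 1).ascFactorial (2 * k' + 1) : ℂ)) *
        ((w + y) ^ (p + 2 * (k' + 1)))⁻¹ := by
      simp only [hF]
      have hm1 : (-1 : ℂ) ^ (2 * k' + 1) = -1 := by
        rw [pow_succ, pow_mul, neg_one_sq, one_pow, one_mul]
      have ez : (-(p + 1 + ((2 * k' + 1 : ℕ) : ℤ)) : ℤ) = -(((p + 2 * (k' + 1) : ℕ)) : ℤ) := by push_cast; ring
      rw [hm1, ez, zpow_neg, zpow_natCast]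
      ring
    rw [hFval]
    ring
  have hF2 : ∀ y : ℝ, (1 : ℂ) / ((2 * ν + 1).factorial : ℂ) * ((bernoulliPer (2 * ν + 1) y : ℂ) * F (2 * ν + 1) y)
      = -((A : ℂ) * ((bernoulliPer (2 * ν + 1) y : ℂ) * (w + y) ^ (-((p + 2 * ν : ℕ) + 2 : ℤ)))) := by
    intro y
    simp only [hF, hA]
    rw [pow_succ, pow_mul, neg_one_sq, one_pow, one_mul]
    have ez : (-(p + 1 + ((2 * ν + 1 : ℕ) : ℤ)) : ℤ) = -(((p + 2 * ν : ℕ) : ℤ) + 2) := by push_cast; ring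
    rw [ez]
    have hf : (((2 * ν + 1).factorial : ℕ) : ℂ) ≠ 0 := by exact_mod_cast Nat.factorial_ne_zero _
    push_cast
    field_simp
  -- `∫_0^n F_0 = (w^{-p} − (w+n)^{-p})/p`
  have hI : ∀ n : ℕ, ∫ x in ((0 : ℕ) : ℝ)..n, F 0 x = (w ^ p)⁻¹ / p - ((w + n) ^ p)⁻¹ / p := by
    intro n
    have hn0 : (0 : ℝ) ≤ n := Nat.cast_nonneg n
    have hderiv : ∀ x ∈ uIcc (0 : ℝ) n,
        HasDerivAt (fun y : ℝ ↦ -((w + y) ^ (-(p : ℤ))) / p) (F 0 x) x := by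
      intro x hx
      rw [uIcc_of_le hn0] at hx
      have hne : w + (x : ℂ) ≠ 0 := add_ofReal_ne_zero' hw hx.1
      have h1 := hasDerivAt_zpow (-(p : ℤ)) (w + (x : ℂ)) (Or.inl hne)
      have h2 : HasDerivAt (fun z : ℂ ↦ w + z) 1 (x : ℂ) := (hasDerivAt_id _).const_add w
      have h3 := (h1.comp (x : ℂ) h2).comp_ofReal
      have h4 := (h3.neg).div_const (p : ℂ)
      simp only [Function.comp_def, mul_one] at h4
      rw [hF0 x hx.1]
      refine h4.congr_deriv ?_
      rw [show (-(p : ℤ) - 1 : ℤ) = -((p + 1 : ℕ) : ℤ) by push_cast; ring, zpow_neg, zpow_natCast]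
      field_simp
      push_cast
      ring
    have hcont : ContinuousOn (F 0) (uIcc (0 : ℝ) n) := by
      rw [uIcc_of_le hn0]
      intro x hx
      exact (hFderiv n 0 x (by simpa using hx)).continuousAt.continuousWithinAt
    rw [Nat.cast_zero, integral_eq_sub_of_hasDerivAt hderiv hcont.intervalIntegrable]
    rw [show (-(p : ℤ)) = -((p : ℕ) : ℤ) by simp, zpow_neg, zpow_neg, zpow_natCast, zpow_natCast]
    push_cast
    ring
  -- remainder bound
  have hR : ∀ n : ℕ, ‖∫ x in (0 : ℝ)..n, (bernoulliPer (2 * ν + 1) x : ℂ) *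
      (w + x) ^ (-((p + 2 * ν : ℕ) + 2 : ℤ))‖ ≤ C / (‖w‖ ^ (p + 2 * ν) * w.re) := by
    intro n
    exact norm_integral_bernoulliPer_mul_zpow_le' hw hν (p + 2 * ν) n
  -- Euler–Maclaurin at finite `n` and the identity
  have hkey : ∀ n : ℕ, ‖(∑ j ∈ Finset.range (n + 1), ((w + j) ^ (p + 1))⁻¹) -
      (-(((w + n) ^ p)⁻¹ / p) + ((w + n) ^ (p + 1))⁻¹ / 2 -
        ∑ k ∈ Finset.Icc 1 ν, (bernoulli (2 * k) : ℂ) / ((2 * k).factorial : ℂ) *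
          ((p + 1).ascFactorial (2 * k - 1) : ℂ) * ((w + n) ^ (p + 2 * k))⁻¹) - Main‖ ≤ Bnd := by
    intro n
    have hEM := eulerMaclaurin_family (hFderiv n) (Nat.zero_le n) ν
    rw [hI n, Nat.cast_zero] at hEM
    have hS : ∑ j ∈ Finset.range (n + 1), ((w + j) ^ (p + 1))⁻¹ = (w ^ (p + 1))⁻¹ + ∑ m ∈ Finset.Ioc 0 n, F 0 m := by
      rw [sum_range_succ_eq_add_sum_Ioc']
      congr 1
      · simp
      · refine Finset.sum_congr rfl fun m _ ↦ ?_
        rw [hF0 m (Nat.cast_nonneg m), Complex.ofReal_natCast]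
    have hF0n : F 0 n = ((w + n) ^ (p + 1))⁻¹ := by rw [hF0 n (Nat.cast_nonneg n), Complex.ofReal_natCast]
    have hF00 : F 0 0 = (w ^ (p + 1))⁻¹ := by
      have := hF0 0 le_rfl
      rw [Complex.ofReal_zero, add_zero] at this
      exact this
    have hsumK : ∑ k ∈ Finset.Icc 1 ν, (bernoulli (2 * k) : ℂ) / (2 * k).factorial *
        (F (2 * k - 1) n - F (2 * k - 1) 0) =
        -(∑ k ∈ Finset.Icc 1 ν, (bernoulli (2 * k) : ℂ) / ((2 * k).factorial : ℂ) *
            ((p + 1).ascFactorial (2 * k - 1) : ℂ) * ((w + n) ^ (p + 2 * k))⁻¹) +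
          ∑ k ∈ Finset.Icc 1 ν, (bernoulli (2 * k) : ℂ) / (2 * k).factorial *
            ((p + 1).ascFactorial (2 * k - 1) : ℂ) / w ^ (p + 2 * k) := by
      rw [← Finset.sum_neg_distrib, ← Finset.sum_add_distrib]
      refine Finset.sum_congr rfl fun k hk ↦ ?_
      have hk1 : 1 ≤ k := (Finset.mem_Icc.mp hk).1
      have h1 := hF1 k hk1 n (Nat.cast_nonneg n)
      have h0 := hF1 k hk1 0 le_rfl
      rw [Complex.ofReal_natCast] at h1
      rw [Complex.ofReal_zero, add_zero] at h0
      rw [mul_sub, h1, h0, div_eq_mul_inv _ (w ^ (p + 2 * k))]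
      ring
    have hRn : 1 / ((2 * ν + 1).factorial : ℂ) *
        ∫ x in (0 : ℝ)..n, (bernoulliPer (2 * ν + 1) x : ℂ) * F (2 * ν + 1) x =
        -((A : ℂ) * ∫ x in (0 : ℝ)..n, (bernoulliPer (2 * ν + 1) x : ℂ) *
          (w + x) ^ (-((p + 2 * ν : ℕ) + 2 : ℤ))) := by
      rw [← intervalIntegral.integral_const_mul, ← intervalIntegral.integral_const_mul,
        ← intervalIntegral.integral_neg]
      refine intervalIntegral.integral_congr fun x _ ↦ ?_
      exact hF2 x
    have hid : (∑ j ∈ Finset.range (n + 1), ((w + j) ^ (p + 1))⁻¹) -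
        (-(((w + n) ^ p)⁻¹ / p) + ((w + n) ^ (p + 1))⁻¹ / 2 -
          ∑ k ∈ Finset.Icc 1 ν, (bernoulli (2 * k) : ℂ) / ((2 * k).factorial : ℂ) *
            ((p + 1).ascFactorial (2 * k - 1) : ℂ) * ((w + n) ^ (p + 2 * k))⁻¹) - Main =
        -((A : ℂ) * ∫ x in (0 : ℝ)..n, (bernoulliPer (2 * ν + 1) x : ℂ) *
          (w + x) ^ (-((p + 2 * ν : ℕ) + 2 : ℤ))) := by
      rw [hS, hEM, hsumK, hRn, hF0n, hF00, hMain]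
      field_simp
      ring
    rw [hid, norm_neg, norm_mul, Complex.norm_real, Real.norm_eq_abs, abs_of_nonneg hA0, hBnd, mul_div_assoc]
    exact mul_le_mul_of_nonneg_left (hR n) hA0
  -- limits
  have hAlim : Tendsto (fun n : ℕ ↦ ∑ j ∈ Finset.range (n + 1), ((w + j) ^ (p + 1))⁻¹) atTop
      (𝓝 (∑' j : ℕ, ((w + j) ^ (p + 1))⁻¹)) := by
    have h := (summable_inv_pow_add_nat hw hp).hasSum
    exact h.tendsto_sum_nat.comp (tendsto_add_atTop_nat 1)
  have hV : Tendsto (fun n : ℕ ↦ -(((w + n) ^ p)⁻¹ / p) + ((w + n) ^ (p + 1))⁻¹ / 2 -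
      ∑ k ∈ Finset.Icc 1 ν, (bernoulli (2 * k) : ℂ) / ((2 * k).factorial : ℂ) *
        ((p + 1).ascFactorial (2 * k - 1) : ℂ) * ((w + n) ^ (p + 2 * k))⁻¹) atTop (𝓝 0) := by
    have h1 : Tendsto (fun n : ℕ ↦ -(((w + n) ^ p)⁻¹ / p)) atTop (𝓝 0) := by
      have := ((tendsto_inv_pow_add_nat' hw hp).div_const (p : ℂ)).neg
      simpa using this
    have h2 : Tendsto (fun n : ℕ ↦ ((w + n) ^ (p + 1))⁻¹ / 2) atTop (𝓝 0) := by
      have := (tendsto_inv_pow_add_nat' hw (by omega : 1 ≤ p + 1)).div_const 2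
      simpa using this
    have h3 : Tendsto (fun n : ℕ ↦ ∑ k ∈ Finset.Icc 1 ν, (bernoulli (2 * k) : ℂ) / ((2 * k).factorial : ℂ) *
        ((p + 1).ascFactorial (2 * k - 1) : ℂ) * ((w + n) ^ (p + 2 * k))⁻¹) atTop (𝓝 0) := by
      have : Tendsto (fun n : ℕ ↦ ∑ k ∈ Finset.Icc 1 ν, (bernoulli (2 * k) : ℂ) / ((2 * k).factorial : ℂ) *
          ((p + 1).ascFactorial (2 * k - 1) : ℂ) * ((w + n) ^ (p + 2 * k))⁻¹) atTop
          (𝓝 (∑ k ∈ Finset.Icc 1 ν, (bernoulli (2 * k) : ℂ) / ((2 * k).factorial : ℂ) *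
            ((p + 1).ascFactorial (2 * k - 1) : ℂ) * 0)) := by
        refine tendsto_finsetSum _ fun k hk ↦ ?_
        exact (tendsto_inv_pow_add_nat' hw (by omega)).const_mul _
      simpa using this
    have := (h1.add h2).sub h3
    simpa using this
  have hlim : Tendsto (fun n : ℕ ↦ (∑ j ∈ Finset.range (n + 1), ((w + j) ^ (p + 1))⁻¹) -
      (-(((w + n) ^ p)⁻¹ / p) + ((w + n) ^ (p + 1))⁻¹ / 2 -
        ∑ k ∈ Finset.Icc 1 ν, (bernoulli (2 * k) : ℂ) / ((2 * k).factorial : ℂ) *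
          ((p + 1).ascFactorial (2 * k - 1) : ℂ) * ((w + n) ^ (p + 2 * k))⁻¹) - Main) atTop
      (𝓝 ((∑' j : ℕ, ((w + j) ^ (p + 1))⁻¹) - 0 - Main)) := (hAlim.sub hV).sub tendsto_const_nhds
  have hnorm := (continuous_norm.tendsto _).comp hlim
  have hle := le_of_tendsto' hnorm hkey
  simpa [hMain, hBnd, hC, hA] using hle

/-! ### The polygamma functions -/

/-- **Stirling's series for `ψ^{(p)}` with an explicit remainder** (`Re w > 0`, `p ≥ 1`, `ν ≥ 1`): with
`M = 1/(p w^p) + 1/(2w^{p+1}) + Σ_{k=1}^{ν} (B_{2k}/(2k)!) (p+1)^{(2k−1)}/w^{p+2k}`,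
`‖ψ^{(p)}(w) − (−1)^{p+1} p!·M‖ ≤ p! · ((p+1)^{(2ν+1)}/(2ν+1)!) (π²/3)(2ν+1)!/(2π)^{2ν+1} / (‖w‖^{p+2ν} Re w)`
(DLMF 5.15.8 with every coefficient `(−1)^{p+1}(p+2k−1)! B_{2k}/(2k)!` written as `p!·(p+1)^{(2k−1)}·B_{2k}/(2k)!`).
[cite: DLMF, 5.15.8] -/
theorem norm_iteratedDeriv_digamma_sub_stirling_le {w : ℂ} (hw : 0 < w.re) {p : ℕ} (hp : 1 ≤ p) {ν : ℕ}
    (hν : ν ≠ 0) :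
    ‖iteratedDeriv p Complex.digamma w - (-1) ^ (p + 1) * (p.factorial : ℂ) *
        (1 / (p * w ^ p) + 1 / (2 * w ^ (p + 1)) +
          ∑ k ∈ Finset.Icc 1 ν, (bernoulli (2 * k) : ℂ) / (2 * k).factorial *
            ((p + 1).ascFactorial (2 * k - 1) : ℂ) / w ^ (p + 2 * k))‖ ≤
      (p.factorial : ℝ) * ((((p + 1).ascFactorial (2 * ν + 1) : ℝ) / (2 * ν + 1).factorial) *
        (Real.pi ^ 2 / 3 * ((2 * ν + 1).factorial : ℝ) / (2 * Real.pi) ^ (2 * ν + 1)) /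
        (‖w‖ ^ (p + 2 * ν) * w.re)) := by
  have hS := (hasSum_iteratedDeriv_digamma hw hp).tsum_eq
  rw [tsum_mul_left] at hS
  rw [← hS, ← mul_sub, norm_mul, norm_mul, norm_pow, norm_neg, norm_one, one_pow, one_mul,
    Complex.norm_natCast]
  exact mul_le_mul_of_nonneg_left (norm_tsum_inv_pow_sub_stirling_le hw hp hν) (Nat.cast_nonneg _)

end Literature.Analysis.SpecialFunctions.Complex

end
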